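import Summits.Ventures.HSemireg.UntwistCocycleTwistJet
import HarnessLib

/-!
# Venture HSemireg — route R1.0, untwisted reading: the Leibniz COCYCLE identity for the jet sequences of `E` and
# `E ⊗ M` (gs-g4; sequel of `UntwistCocycleTwistJet.lean`)

HONEST FRAMING. Module-level sheaf algebra on the tree's REAL carriers: Atiyah's jet module `P¹(E)` and its sequence
(`HodgeTheory/AtiyahClass.lean`), th-4's cocycle twist `E⟨c⟩ = E ⊗ M` (files #11–#14), the comparison
`λ = CocycleTwist.dualHomTwist` and `J_x` of the previous file. Nothing about any variety; no gerbe; nothing here says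
HC, HC_CM or HC_AV is proved.

WHAT IS PROVED (sections only; the `Ext`-classes are compared in `UntwistCocycleTwistAtiyah.lean`):

* `jetSectionTwist` / `jetSectionUntwist` — a local section `s : E| → P¹(E)|` of `π` over `W ⊆ U_x` transported to a
  section `t_x⁻¹ ≫ s ≫ J_x` of `P¹(E⟨c⟩) → E⟨c⟩` resp. `t_x⁻¹ ≫ s ≫ t_x^{P¹(E)}` of `P¹(E)⟨c⟩ → E⟨c⟩` (`_comp_π`);
* `appLE_jetSectionUntwist_sub`, `appLE_jetSectionTwist_sub` — **the Leibniz cocycle identity**: for sections `s_x`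
  over `W_x ⊆ U_x` and `s_y` over `W_y ⊆ U_y` and `e` a section of `E⟨c⟩` below both, with `e_x = t_x⁻¹ e` and
  `D = (s_x(e_x) - s_y(e_x)).snd` (the `E`-side difference cocycle; `diffForm`):
  `s̃_x(e) - s̃_y(e) = ι⟨c⟩(D ⊗ t_x)` for the untwisted transport, but
  `ŝ_x(e) - ŝ_y(e) = ι'(λ(D ⊗ t_x) + e ⊗ ω_{xy})`, `ω_{xy} = -g_{xy} d g_{yx}` (`dlogForm`), for the jet module of
  `E⟨c⟩` — the extra term is Atiyah's `dlog` of the transition function: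
  `s_y(g_{yx} e_x) = g_{yx} s_y(e_x) + e_x ⊗ d g_{yx}` in `P¹(E)`.

Which Ext groups: none yet; which twist: `- ⊗ M_B`, `M_B = lineBundle c`.

## References

* M. F. Atiyah, *Complex analytic connections in fibre bundles*, Trans. AMS 85 (1957), §4, Prop. 10, Prop. 12
  (`b(L) = {d log g_{ij}}`). [Atiyah1957]
* R.-O. Buchweitz, H. Flenner, Compositio Math. 137 (2003), §3 (Atiyah class). [BuchweitzFlenner2003]
-/

noncomputable section

open CategoryTheory AlgebraicGeometry Opposite TopologicalSpace

namespace Summit.Ventures.HSemireg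

namespace CocycleTwist

open Literature.AlgebraicGeometry.Modules Literature.AlgebraicGeometry.Motives
  Literature.AlgebraicGeometry.HodgeTheory

universe u

variable {S : Type u} [CommRing S] {X : Over (Spec (CommRingCat.of S))} (c : UnitCocycle X.left)
  (E : X.left.Modules)

/-! ### A local section of `P¹(E) → E` transported along `t_x` -/

/-- First components of the values of a section `s` of `π : P¹(E) → E` over `W`: `(s e).fst = e`. [folklore] -/
theorem fst_appLE_section {W : X.left.Opens} (s : E.over W ⟶ (jetModule E).over W)
    (hs : s ≫ (SheafOfModules.overFunctor _ W).map (jetπ E) = 𝟙 _) {V : X.left.Opens} (k : V ⟶ W) (e : Γ(E, V)) :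
    JetSections.fst (appLE s k e : JetSections E V) = e := by
  have h := congrArg (fun φ => appLE φ k e) hs
  simp only [appLE_comp, appLE_over_map, appLE_id, jetπ_app_apply] at h
  exact h

/-- `t_x⁻¹ ≫ t_x = 𝟙` (the second triangle of th-4's `twistTrivOver`). [folklore] -/
theorem ofTwistOver_comp_toTwistOver (x : X.left) (W : X.left.Opens) (hW : W ≤ c.U x) :
    ofTwistOver c E x W hW ≫ toTwistOver c E x W hW = 𝟙 _ :=
  (twistTrivOver c E x W hW).inv_hom_id

section Sections

variable (x : X.left) (W : X.left.Opens) (hW : W ≤ c.U x) (s : E.over W ⟶ (jetModule E).over W)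

/-- **The section of `P¹(E)⟨c⟩ → E⟨c⟩` over `W ⊆ U_x` transported from `s`**: `t_x⁻¹ ≫ s ≫ t_x^{P¹(E)}`
(`e ↦ s(e_x) ⊗ t_x`). [folklore] -/
def jetSectionUntwist : (twist c E).over W ⟶ (twist c (jetModule E)).over W :=
  ofTwistOver c E x W hW ≫ s ≫ toTwistOver c (jetModule E) x W hW

/-- **The section of `P¹(E⟨c⟩) → E⟨c⟩` over `W ⊆ U_x` transported from `s`**: `t_x⁻¹ ≫ s ≫ J_x`
(`e ↦ J_x(s(e_x))`). [folklore] -/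
def jetSectionTwist : (twist c E).over W ⟶ (jetModule (twist c E)).over W :=
  ofTwistOver c E x W hW ≫ s ≫ jetTwistOver c E x W hW

variable (hs : s ≫ (SheafOfModules.overFunctor _ W).map (jetπ E) = 𝟙 _)

include hs in
/-- `t_x⁻¹ ≫ s ≫ t_x^{P¹(E)}` is a section of `π⟨c⟩ : P¹(E)⟨c⟩ → E⟨c⟩`. [folklore] -/
theorem jetSectionUntwist_comp_π :
    jetSectionUntwist c E x W hW s ≫ (SheafOfModules.overFunctor _ W).map (twistMap c (jetπ E)) = 𝟙 _ := by
  refine hom_ext_of_appLE fun V k e => ?_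
  rw [jetSectionUntwist, appLE_comp, appLE_comp, appLE_comp, appLE_over_map, appLE_toTwistOver,
    twistMap_app_trivSection, jetπ_app_apply, fst_appLE_section E s hs, ← appLE_toTwistOver c E x W hW k,
    ← appLE_comp, ofTwistOver_comp_toTwistOver]

include hs in
/-- `t_x⁻¹ ≫ s ≫ J_x` is a section of `π' : P¹(E⟨c⟩) → E⟨c⟩`. [folklore] -/
theorem jetSectionTwist_comp_π :
    jetSectionTwist c E x W hW s ≫ (SheafOfModules.overFunctor _ W).map (jetπ (twist c E)) = 𝟙 _ := by
  refine hom_ext_of_appLE fun V k e => ?_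
  rw [jetSectionTwist, appLE_comp, appLE_comp, appLE_comp, appLE_over_map, jetπ_app_apply, appLE_jetTwistOver,
    jetTwistFun_fst, fst_appLE_section E s hs, ← appLE_toTwistOver c E x W hW k, ← appLE_comp,
    ofTwistOver_comp_toTwistOver]

end Sections

/-! ### The Leibniz cocycle identity -/

section Cocycle

/-- The `x`-coordinate `e_x ∈ Γ(E, V)` of a section of `E⟨c⟩` over `V ⊆ U_x`. [folklore] -/
abbrev coordAt (x : X.left) {V : X.left.Opens} (hV : V ≤ c.U x) (e : Γ(twist c E, V)) : Γ(E, V) :=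
  appLE (ofTwistOver c E x V hV) (𝟙 V) e

/-- `e_x ⊗ t_x = e`. [folklore] -/
theorem trivSection_coordAt (x : X.left) {V : X.left.Opens} (hV : V ≤ c.U x) (e : Γ(twist c E, V)) :
    trivSection c E x hV (coordAt c E x hV e) = e := by
  rw [coordAt, ← appLE_toTwistOver c E x V hV (𝟙 V), ← appLE_comp, ofTwistOver_comp_toTwistOver, appLE_id]

/-- The `y`-coordinate is `g_{yx}` times the `x`-coordinate (over `V ⊆ U_x ∩ U_y`). [folklore] -/
theorem coordAt_eq_smul (x y : X.left) {V : X.left.Opens} (hx : V ≤ c.U x) (hy : V ≤ c.U y) (e : Γ(twist c E, V)) :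
    coordAt c E y hy e = c.g y x V hy hx • coordAt c E x hx e := by
  conv_lhs => rw [← trivSection_coordAt c E x hx e, trivSection_eq_trivSection_smul c E x y hx hy]
  exact appLE_twistTrivOver_inv_trivSection c y V hy _

variable {x y : X.left} {Wx Wy : X.left.Opens} (hx : Wx ≤ c.U x) (hy : Wy ≤ c.U y)
  (sx : E.over Wx ⟶ (jetModule E).over Wx) (sy : E.over Wy ⟶ (jetModule E).over Wy)
  {V : X.left.Opens} (kx : V ⟶ Wx) (ky : V ⟶ Wy) (e : Γ(twist c E, V))

/-- **The `E`-side difference form** `D_{xy}(e) = (s_x(e_x) - s_y(e_x)).snd ∈ Γ(E ⊗ Ω¹, V)`: the difference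
cocycle of the two local sections, evaluated on the `x`-coordinate (for frame sections this is the Atiyah
cocycle `{dT T⁻¹}` of `E`). [cite: Atiyah1957, §4] -/
def diffForm : Γ(twistCotangent E, V) :=
  (JetSections.snd ((appLE sx kx (coordAt c E x (kx.le.trans hx) e) : JetSections E V) -
    (appLE sy ky (coordAt c E x (kx.le.trans hx) e) : JetSections E V)) :
    (dual E).over V ⟶ (cotangentSheaf X).over V)

/-- The scalar `1`-form `ω_{xy} = -g_{xy} · d g_{yx}` (`= d log g_{xy}` as `g_{xy} g_{yx} = 1`) over
`V ⊆ U_x ∩ U_y`: the Atiyah cocycle of the line bundle `M = lineBundle c` in the frames `t_x`.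
[cite: Atiyah1957, Prop. 12] -/
def dlogForm (x y : X.left) (V : X.left.Opens) (hx : V ≤ c.U x) (hy : V ≤ c.U y) : Γ(cotangentSheaf X, V) :=
  -(c.g x y V hx hy • dSection X V (c.g y x V hy hx))

variable (hsx : sx ≫ (SheafOfModules.overFunctor _ Wx).map (jetπ E) = 𝟙 _)
  (hsy : sy ≫ (SheafOfModules.overFunctor _ Wy).map (jetπ E) = 𝟙 _)

include hsx hsy in
/-- **Untwisted transport: `s̃_x(e) - s̃_y(e) = ι⟨c⟩(D_{xy}(e) ⊗ t_x)`** — the difference of the transported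
sections of `P¹(E)⟨c⟩ → E⟨c⟩` is the twist of the `E`-side difference (`s_y(g_{yx} e_x) ⊗ t_y = s_y(e_x) ⊗ t_x`:
`s_y` is linear and `p ⊗ t_x = (g_{yx} p) ⊗ t_y`). [cite: Atiyah1957, §4] -/
theorem appLE_jetSectionUntwist_sub :
    appLE (jetSectionUntwist c E x Wx hx sx) kx e - appLE (jetSectionUntwist c E y Wy hy sy) ky e =
      (twistMap c (jetι E)).app V
        (trivSection c (twistCotangent E) x (kx.le.trans hx) (diffForm c E hx sx sy kx ky e)) := by
  have hxV : V ≤ c.U x := kx.le.trans hx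
  have hyV : V ≤ c.U y := ky.le.trans hy
  rw [jetSectionUntwist, jetSectionUntwist, appLE_comp, appLE_comp, appLE_comp, appLE_comp, appLE_toTwistOver,
    appLE_toTwistOver, twistMap_app_trivSection, jetι_app_apply]
  have ex : appLE (ofTwistOver c E x Wx hx) kx e = coordAt c E x hxV e := rfl
  have ey : appLE (ofTwistOver c E y Wy hy) ky e = coordAt c E y hyV e := rfl
  rw [ex, ey, coordAt_eq_smul c E x y hxV hyV e, appLE_smul_right,
    ← trivSection_eq_trivSection_smul c (jetModule E) x y hxV hyV, ← trivSection_sub]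
  congr 1
  refine JetSections.ext ?_ rfl
  change JetSections.fst (appLE sx kx (coordAt c E x hxV e) : JetSections E V) -
      JetSections.fst (appLE sy ky (coordAt c E x hxV e) : JetSections E V) = (0 : Γ(E, V))
  rw [fst_appLE_section E sx hsx, fst_appLE_section E sy hsy, sub_self]

include hsx hsy in
/-- **Twisted transport — the Leibniz cocycle identity
`ŝ_x(e) - ŝ_y(e) = ι'(λ(D_{xy}(e) ⊗ t_x) + e ⊗ ω_{xy})`**, `ω_{xy} = -g_{xy} d g_{yx}`: the difference of the
transported sections of `P¹(E⟨c⟩) → E⟨c⟩` is `λ` of the twisted `E`-side difference PLUS the scalar term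
`e ⊗ dlog g_{xy}` — because `s_y(g_{yx} e_x) = g_{yx} s_y(e_x) + e_x ⊗ d g_{yx}` in `P¹(E)` (the twisted module
structure) and `λ((e_x ⊗ d g_{yx}) ⊗ t_y) = (e_x ⊗ t_y) ⊗ d g_{yx} = g_{xy} (e ⊗ d g_{yx})`.
[cite: Atiyah1957, §4 and Prop. 12] -/
theorem appLE_jetSectionTwist_sub :
    appLE (jetSectionTwist c E x Wx hx sx) kx e - appLE (jetSectionTwist c E y Wy hy sy) ky e =
      (jetι (twist c E)).app V
        ((dualHomTwist c E (cotangentSheaf X)).app V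
            (trivSection c (twistCotangent E) x (kx.le.trans hx) (diffForm c E hx sx sy kx ky e)) +
          tensorForm (twist c E) (cotangentSheaf X) e (dlogForm c x y V (kx.le.trans hx) (ky.le.trans hy))) := by
  have hxV : V ≤ c.U x := kx.le.trans hx
  have hyV : V ≤ c.U y := ky.le.trans hy
  rw [jetSectionTwist, jetSectionTwist, appLE_comp, appLE_comp, appLE_comp, appLE_comp, appLE_jetTwistOver,
    appLE_jetTwistOver, jetι_app_apply]
  have ex : appLE (ofTwistOver c E x Wx hx) kx e = coordAt c E x hxV e := rfl
  have ey : appLE (ofTwistOver c E y Wy hy) ky e = coordAt c E y hyV e := rfl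
  rw [ex, ey, coordAt_eq_smul c E x y hxV hyV e, appLE_smul_right]
  refine JetSections.ext ?_ ?_
  · -- first components: both transported sections start with `e`
    change (jetTwistFun c E x hxV (appLE sx kx (coordAt c E x hxV e))).fst -
        (jetTwistFun c E y hyV (c.g y x V hyV hxV • appLE sy ky (coordAt c E x hxV e))).fst = (0 : Γ(twist c E, V))
    rw [jetTwistFun_fst, jetTwistFun_fst, fst_smul_sections, fst_appLE_section E sx hsx, fst_appLE_section E sy hsy,
      ← trivSection_eq_trivSection_smul c E x y hxV hyV, sub_self]
  · -- second components: the Leibniz rule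
    change (jetTwistFun c E x hxV (appLE sx kx (coordAt c E x hxV e))).snd -
        (jetTwistFun c E y hyV (c.g y x V hyV hxV • appLE sy ky (coordAt c E x hxV e))).snd = _
    rw [jetTwistFun_snd, jetTwistFun_snd, snd_smul_sections, fst_appLE_section E sy hsy, trivSection_add_hom, map_add,
      ← trivSection_eq_trivSection_smul_hom c x y hxV hyV, deltaHom_eq_tensorForm,
      dualHomTwist_app_trivSection_tensorForm, trivSection_eq_trivSection_smul c E y x hyV hxV, trivSection_smul,
      trivSection_coordAt, tensorForm_smul_left, JetSections.snd_mk, diffForm, dlogForm, tensorForm_neg_right,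
      tensorForm_smul_right, snd_sub_sections, trivSection_sub_hom, map_sub]
    abel

end Cocycle

end CocycleTwist

end Summit.Ventures.HSemireg

end
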